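import Mathlib
import HarnessLib

/-!
# The bosonic birthday paradox: collision-free probabilities for bosons and for boltzmannons

Topic `Literature/Combinatorics/Enumerative`.  Source: A. Arkhipov, G. Kuperberg, *The bosonic
birthday paradox*, Geometry & Topology Monographs **18** (2012) 1–7 = arXiv:1106.0849
[ArkhipovKuperberg2012] (held text `paper:arxiv-1106.0849`): §1 — “In the traditional version of the
classical birthday problem, we assume the uniform distribution on all n^k choices of the birthdays of
the k people”; the uniform state `ρ_unif` on the symmetric power `S^k(𝓗)` of `k` bosons with `n`
modes, for which “the measurement … of all birthdays of ρ_unif yields the uniform distribution μ_unif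
on configurations of k unlabelled people with n possible birthdays” (Prop. 1 / Cor. 2: every state
becomes `ρ_unif` after a Haar-random mode unitary); §2, the display before Corollary 4 — “The
probability that all of the birthdays are distinct is
`C(n,k) / ((n multichoose k)) = ∏_{a=0}^{k−1} (1 − a/n)/(1 + a/n) ∼ e^{−k²/n}`”, and Corollary 4 —
“For n modes, we need k ∼ √(n ln 2) bosons to expect a repeated birthday with majority probability.
This differs by only a constant factor from the k ∼ √(2n ln 2) people needed … in the classical
birthday problem with distinguishable people.”  The classical exponential bound is Problem 1.12 of
H.-O. Georgii, *Stochastics*, 2nd ed., de Gruyter 2012 (“Show (using the inequality 1 − x ≤ e^{−x})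
that p_n ≥ 1 − exp(−n(n−1)/730)”) [Georgii2012].

HONEST FRAMING (pub-qadeq lane context, CLAIMS rows E-11…E-15: the boson-sampling rows' talk of
PHOTON COLLISIONS — Jiuzhang 1.0's note added “In our work, collision modes dominate … the new
algorithm [for non-collision GBS] cannot be readily used”, Jiuzhang 3.0's motivation for
pseudo-photon-number-resolving detection “there was a possibility of photon collision, that is, the
photons can bunch at the outputs. New classical algorithms could exploit photon collision”):
instance-level adjudication of specific advantage claims; no claim about BQP vs BPP or the summit.
This file proves the two finite collision-free probabilities and their elementary bounds; it does
NOT formalise the symmetric-power Hilbert space or the measurement statement of §1 (the uniform law on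
multisets is the INPUT here), and says nothing about any experiment's photon statistics (which are
neither uniform nor Haar-averaged).

## Contents (all proved, 0 named facts)

* Counting: `card_bosonConfigurations` (`# Sym (Fin n) k = (n multichoose k)`, unlabelled bosons —
  the support of `μ_unif`), `card_collisionFreeBoson` (`#{k-subsets} = C(n,k)`); the labelled counts
  `n^k` and `n(n−1)⋯(n−k+1)` are Mathlib's `Fintype.card_fun` / `Fintype.card_embedding_eq`.
* `classicalCF n k = n^{(k)}/n^k` and `bosonCF n k = C(n,k)/(n multichoose k)` — the two
  probabilities that all birthdays are distinct under the respective uniform laws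
  [cite: ArkhipovKuperberg2012, §1–§2].
* **`bosonCF_eq_prod`** — the displayed identity `C(n,k)/(n multichoose k) = ∏_{a<k}(1 − a/n)/(1 + a/n)`
  [cite: ArkhipovKuperberg2012, §2 (display before Cor. 4)]; `classicalCF_eq_prod`
  (`= ∏_{a<k}(1 − a/n)`).
* `bosonCF_le_classicalCF` — “bosons prefer to have the same birthday”: the bosonic collision-free
  probability never exceeds the classical one [cite: ArkhipovKuperberg2012, §1].
* `classicalCF_le_exp` — `∏_{a<k}(1 − a/n) ≤ exp(−k(k−1)/(2n))` [cite: Georgii2012, Problem 1.12];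
  `bosonCF_le_exp` — `≤ exp(−k(k−1)/(n+k))`, a finite one-sided form of the source's
  `∼ e^{−k²/n}` (twice the classical exponent for `k ≪ n`: the “factor of √2” of Cor. 4)
  [cite: ArkhipovKuperberg2012, §2 Cor. 4].
-/

noncomputable section

namespace Literature.Combinatorics.Enumerative.BosonicBirthday

open Finset Nat Real

/-! ## Counting configurations -/

-- The labelled counts `#(Fin k → Fin n) = n^k` and `#(Fin k ↪ Fin n) = n(n−1)⋯(n−k+1)` are
-- Mathlib's `Fintype.card_fun` / `Fintype.card_embedding_eq` (in the tree also as
-- `Literature.Barriers.MatrixMultiplication.card_fin_fun`, `…QuantumComplexity.card_plantedPositions`).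

/-- Configurations of `k` unlabelled bosons among `n` modes (multisets): `(n multichoose k)` — the
support of the uniform law `μ_unif`. [cite: ArkhipovKuperberg2012, §1 (“configurations of k unlabelled people with n possible birthdays”; the multiset coefficient)] -/
theorem card_bosonConfigurations (n k : ℕ) : Fintype.card (Sym (Fin n) k) = n.multichoose k := by
  rw [Sym.card_sym_eq_multichoose]; simp

/-- Collision-free bosonic configurations = `k`-element subsets: `C(n,k)` of them.
[cite: ArkhipovKuperberg2012, §2 (numerator of the display before Cor. 4)] -/
theorem card_collisionFreeBoson (n k : ℕ) :
    ((univ : Finset (Fin n)).powersetCard k).card = n.choose k := by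
  rw [card_powersetCard]; simp

/-! ## The two collision-free probabilities -/

/-- The classical (boltzmannon) probability that `k` uniformly random birthdays among `n` days are
all distinct: `n(n−1)⋯(n−k+1) / n^k`. [cite: ArkhipovKuperberg2012, §2 (classical birthday problem)] -/
def classicalCF (n k : ℕ) : ℝ := (n.descFactorial k : ℝ) / (n : ℝ) ^ k

/-- The bosonic probability that all birthdays are distinct under the uniform law on multisets:
`C(n,k) / (n multichoose k)`. [cite: ArkhipovKuperberg2012, §2 (display before Cor. 4)] -/
def bosonCF (n k : ℕ) : ℝ := (n.choose k : ℝ) / (n.multichoose k : ℝ)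

/-- `(n multichoose k) · k! = n(n+1)⋯(n+k−1)` (rising factorial). [cite: ArkhipovKuperberg2012, §1 (multiset coefficient)] -/
theorem multichoose_mul_factorial (n k : ℕ) : n.multichoose k * k ! = n.ascFactorial k := by
  rw [Nat.multichoose_eq, mul_comm, ← Nat.ascFactorial_eq_factorial_mul_choose']

/-- `C(n,k) · k! = n(n−1)⋯(n−k+1)` (falling factorial). [cite: ArkhipovKuperberg2012, §2] -/
theorem choose_mul_factorial' (n k : ℕ) : n.choose k * k ! = n.descFactorial k := by
  rw [mul_comm, ← Nat.descFactorial_eq_factorial_mul_choose]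

/-- `bosonCF n k = (∏_{a<k}(n − a)) / (∏_{a<k}(n + a))` (the factorials cancel).
[cite: ArkhipovKuperberg2012, §2 (display before Cor. 4)] -/
theorem bosonCF_eq_desc_div_asc (n k : ℕ) :
    bosonCF n k = (n.descFactorial k : ℝ) / (n.ascFactorial k : ℝ) := by
  unfold bosonCF
  have hk : (k ! : ℝ) ≠ 0 := by exact_mod_cast (Nat.factorial_pos k).ne'
  rw [← choose_mul_factorial', ← multichoose_mul_factorial]
  push_cast
  rw [mul_div_mul_right _ _ hk]

/-- **The displayed product formula**: for `n ≥ 1`,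
`C(n,k)/(n multichoose k) = ∏_{a=0}^{k−1} (1 − a/n)/(1 + a/n)`.
[cite: ArkhipovKuperberg2012, §2 (display before Cor. 4)] -/
theorem bosonCF_eq_prod {n : ℕ} (hn : 0 < n) (k : ℕ) :
    bosonCF n k = ∏ a ∈ range k, (1 - (a : ℝ) / n) / (1 + (a : ℝ) / n) := by
  have hnR : (0 : ℝ) < n := by exact_mod_cast hn
  by_cases hk : k ≤ n
  · rw [bosonCF_eq_desc_div_asc, Nat.descFactorial_eq_prod_range, Nat.ascFactorial_eq_prod_range]
    push_cast
    rw [← Finset.prod_div_distrib]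
    refine prod_congr rfl fun a ha => ?_
    have ha' : a < k := mem_range.mp ha
    have han : a ≤ n := by omega
    rw [Nat.cast_sub han]
    field_simp
  · -- both sides vanish: `C(n,k) = 0` and the factor `a = n` of the product is zero
    have hk' : n < k := not_le.mp hk
    have h0 : bosonCF n k = 0 := by
      unfold bosonCF; rw [Nat.choose_eq_zero_of_lt hk']; simp
    rw [h0, eq_comm]
    exact prod_eq_zero (mem_range.mpr hk') (by rw [div_self hnR.ne']; simp)

/-- The classical collision-free probability as a product: `n^{(k)}/n^k = ∏_{a<k}(1 − a/n)` (`n ≥ 1`).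
[cite: ArkhipovKuperberg2012, §2 (classical birthday problem)] -/
theorem classicalCF_eq_prod {n : ℕ} (hn : 0 < n) (k : ℕ) :
    classicalCF n k = ∏ a ∈ range k, (1 - (a : ℝ) / n) := by
  have hnR : (0 : ℝ) < n := by exact_mod_cast hn
  by_cases hk : k ≤ n
  · unfold classicalCF
    rw [Nat.descFactorial_eq_prod_range]
    push_cast
    have hpow : (n : ℝ) ^ k = ∏ _a ∈ range k, (n : ℝ) := by simp
    rw [hpow, ← Finset.prod_div_distrib]
    refine prod_congr rfl fun a ha => ?_
    have han : a ≤ n := by have := mem_range.mp ha; omega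
    rw [Nat.cast_sub han]
    field_simp
  · have hk' : n < k := not_le.mp hk
    have h0 : classicalCF n k = 0 := by
      unfold classicalCF; rw [Nat.descFactorial_eq_zero_iff_lt.mpr hk']; simp
    rw [h0, eq_comm]
    exact prod_eq_zero (mem_range.mpr hk') (by rw [div_self hnR.ne']; simp)

/-- **Bosons prefer to have the same birthday**: the bosonic collision-free probability never exceeds
the classical one. [cite: ArkhipovKuperberg2012, §1 (“although bosons prefer to have the same birthday”)] -/
theorem bosonCF_le_classicalCF {n : ℕ} (hn : 0 < n) (k : ℕ) : bosonCF n k ≤ classicalCF n k := by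
  have hnR : (0 : ℝ) < n := by exact_mod_cast hn
  by_cases hk : k ≤ n
  · rw [bosonCF_eq_prod hn, classicalCF_eq_prod hn]
    refine prod_le_prod (fun a ha => ?_) (fun a ha => ?_)
    · have han : (a : ℝ) ≤ n := by exact_mod_cast (by have := mem_range.mp ha; omega : a ≤ n)
      exact div_nonneg (by rw [sub_nonneg, div_le_one hnR]; exact han) (by positivity)
    · have han : (a : ℝ) ≤ n := by exact_mod_cast (by have := mem_range.mp ha; omega : a ≤ n)
      have h1 : 0 ≤ 1 - (a : ℝ) / n := by rw [sub_nonneg, div_le_one hnR]; exact han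
      exact div_le_self h1 (le_add_of_nonneg_right (by positivity))
  · have hk' : n < k := not_le.mp hk
    have hb : bosonCF n k = 0 := by unfold bosonCF; rw [Nat.choose_eq_zero_of_lt hk']; simp
    have hc : classicalCF n k = 0 := by
      unfold classicalCF; rw [Nat.descFactorial_eq_zero_iff_lt.mpr hk']; simp
    rw [hb, hc]

/-- A product of factors `1 − x_a` with `x_a ≤ 1` is at most `exp(−Σ x_a)` (from `1 − x ≤ e^{−x}`).
[cite: Georgii2012, Problem 1.12 (“using the inequality 1 − x ≤ e^{−x}”)] -/
theorem prod_one_sub_le_exp_neg_sum {ι : Type*} (s : Finset ι) (x : ι → ℝ)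
    (h1 : ∀ a ∈ s, x a ≤ 1) :
    ∏ a ∈ s, (1 - x a) ≤ Real.exp (-∑ a ∈ s, x a) := by
  rw [← sum_neg_distrib, Real.exp_sum]
  refine prod_le_prod (fun a ha => by linarith [h1 a ha]) fun a _ => ?_
  have := Real.add_one_le_exp (-x a)
  linarith

/-- `Σ_{a<k} a = k(k−1)/2` over the reals (plumbing). [folklore] -/
private theorem sum_range_cast (k : ℕ) : ∑ i ∈ range k, (i : ℝ) = (k : ℝ) * (k - 1) / 2 := by
  induction k with
  | zero => simp
  | succ k ih => rw [sum_range_succ, ih]; push_cast; ring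

/-- **Classical birthday bound**: `n^{(k)}/n^k ≤ exp(−k(k−1)/(2n))`, i.e. a repeated birthday has
probability at least `1 − exp(−k(k−1)/(2n))` (Georgii's `730 = 2·365`).
[cite: Georgii2012, Problem 1.12] -/
theorem classicalCF_le_exp {n : ℕ} (hn : 0 < n) (k : ℕ) :
    classicalCF n k ≤ Real.exp (-((k : ℝ) * (k - 1) / (2 * n))) := by
  have hnR : (0 : ℝ) < n := by exact_mod_cast hn
  by_cases hk : k ≤ n
  · rw [classicalCF_eq_prod hn]
    have hsum : ∑ a ∈ range k, (a : ℝ) / n = (k : ℝ) * (k - 1) / (2 * n) := by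
      rw [← sum_div, sum_range_cast, div_div]
    rw [← hsum]
    exact prod_one_sub_le_exp_neg_sum (range k) (fun a => (a : ℝ) / n)
      (fun a ha => by
        rw [div_le_one hnR]; exact_mod_cast (by have := mem_range.mp ha; omega : a ≤ n))
  · have hk' : n < k := not_le.mp hk
    have hc : classicalCF n k = 0 := by
      unfold classicalCF; rw [Nat.descFactorial_eq_zero_iff_lt.mpr hk']; simp
    rw [hc]; exact (Real.exp_pos _).le

/-- **Bosonic birthday bound**: `C(n,k)/(n multichoose k) ≤ exp(−k(k−1)/(n+k))` — each factor
`(n − a)/(n + a) = 1 − 2a/(n+a) ≤ 1 − 2a/(n+k) ≤ e^{−2a/(n+k)}`; a finite one-sided form of the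
source's `∼ e^{−k²/n}` (twice the classical exponent when `k ≪ n`).
[cite: ArkhipovKuperberg2012, §2 (display before Cor. 4) and Cor. 4] -/
theorem bosonCF_le_exp {n : ℕ} (hn : 0 < n) (k : ℕ) :
    bosonCF n k ≤ Real.exp (-((k : ℝ) * (k - 1) / (n + k))) := by
  have hnR : (0 : ℝ) < n := by exact_mod_cast hn
  by_cases hk : k ≤ n
  · rw [bosonCF_eq_prod hn]
    -- rewrite each factor as (n - a)/(n + a) and bound it by 1 - 2a/(n+k)
    have hfac : ∀ a ∈ range k,
        (1 - (a : ℝ) / n) / (1 + (a : ℝ) / n) ≤ 1 - 2 * (a : ℝ) / (n + k) := by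
      intro a ha
      have ha' : (a : ℝ) < k := by exact_mod_cast mem_range.mp ha
      have ha0 : (0 : ℝ) ≤ a := by positivity
      have hna : (0 : ℝ) < n + a := by linarith
      have hnk : (0 : ℝ) < n + k := by linarith
      have hlhs : (1 - (a : ℝ) / n) / (1 + (a : ℝ) / n) = ((n : ℝ) - a) / (n + a) := by
        field_simp
      rw [hlhs, div_le_iff₀ hna]
      -- (n - a) ≤ (1 - 2a/(n+k)) (n + a)  ⇔  2a(n+a)/(n+k) ≤ 2a  ⇔ n + a ≤ n + k
      have : 2 * (a : ℝ) / (n + k) * (n + a) ≤ 2 * a := by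
        rw [div_mul_eq_mul_div, div_le_iff₀ hnk]; nlinarith
      nlinarith
    have hnonneg : ∀ a ∈ range k, 0 ≤ (1 - (a : ℝ) / n) / (1 + (a : ℝ) / n) := by
      intro a ha
      have han : (a : ℝ) ≤ n := by exact_mod_cast (by have := mem_range.mp ha; omega : a ≤ n)
      exact div_nonneg (by rw [sub_nonneg, div_le_one hnR]; exact han) (by positivity)
    calc ∏ a ∈ range k, (1 - (a : ℝ) / n) / (1 + (a : ℝ) / n)
        ≤ ∏ a ∈ range k, (1 - 2 * (a : ℝ) / (n + k)) := prod_le_prod hnonneg hfac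
      _ ≤ Real.exp (-∑ a ∈ range k, 2 * (a : ℝ) / (n + k)) :=
          prod_one_sub_le_exp_neg_sum (range k) (fun a => 2 * (a : ℝ) / (n + k))
            (fun a ha => by
              have ha' : (a : ℝ) + 1 ≤ k := by exact_mod_cast mem_range.mp ha
              have hnk : (0 : ℝ) < n + k := by positivity
              rw [div_le_one hnk]
              have hkn : (k : ℝ) ≤ n := by exact_mod_cast hk
              linarith)
      _ = Real.exp (-((k : ℝ) * (k - 1) / (n + k))) := by
          congr 1
          have h2 : ∑ a ∈ range k, 2 * (a : ℝ) / (n + k) = (k : ℝ) * (k - 1) / (n + k) := by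
            rw [← sum_div, ← mul_sum, sum_range_cast]; ring
          rw [h2]
  · have hk' : n < k := not_le.mp hk
    have hb : bosonCF n k = 0 := by unfold bosonCF; rw [Nat.choose_eq_zero_of_lt hk']; simp
    rw [hb]; exact (Real.exp_pos _).le

/-! ## Aaronson–Arkhipov's appendix: the converse direction `> 1 − k²/n` and the unitary pigeonhole

Appended (gen 23, second pass).  Source: S. Aaronson, A. Arkhipov, *The computational complexity of
linear optics*, Theory of Computing 9 (2013), Appendix 13 “The bosonic birthday paradox”
[AaronsonArkhipovToC2013] (held text `paper:arxiv-1011.3245` chunks p0062–p0063; the arXiv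
numbering is used for the two results): “the interesting part of the bosonic birthday paradox is
the ‘converse direction’: when m ≫ n², the probability of two or more bosons landing in the same
mode is not too large”; the display
`|G_{m,n}|/|Φ_{m,n}| = C(m,n)/C(m+n−1,n) = (1 − (n−1)/m)(1 − (n−1)/(m+1))⋯(1 − (n−1)/(m+n−1)) > 1 − n²/m`
(proof before Theorem 72, in AA's notation `m` modes / `n` photons = our `n` / `k`); and
**Lemma 69 (Unitary Pigeonhole Principle)**: “Partition a finite set [M] into a ‘good part’ G and
‘bad part’ B = [M] ∖ G … let U be any M × M unitary matrix. Suppose we choose an element x ∈ G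
uniformly at random, apply U to |x⟩, then measure … Then Pr[y ∈ B] ≤ |B|/|G|.  *Proof.* Let R be
an M × M doubly-stochastic matrix whose (x, y) entry is r_xy := |u_xy|² …”.  Theorem 72 itself
(the Haar average `E_U Pr[S ∈ B_{m,n}] < 2n²/m`) is NOT formalised (it needs the Haar measure on
U(m)); the two finite ingredients are. -/

/-- **AA's form of the collision-free ratio**: `C(n,k)/(n multichoose k) = ∏_{i<k} (1 − (k−1)/(n+i))`
(“`= (1 − (n−1)/m)(1 − (n−1)/(m+1))⋯(1 − (n−1)/(m+n−1))`” with AA's `m, n` = our `n, k`).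
[cite: AaronsonArkhipovToC2013, Appendix 13 (display before Thm 72, arXiv numbering)] -/
theorem bosonCF_eq_prod_one_sub {n : ℕ} (hn : 0 < n) (k : ℕ) :
    bosonCF n k = ∏ i ∈ range k, (1 - ((k : ℝ) - 1) / (n + i)) := by
  have hnR : (0 : ℝ) < n := by exact_mod_cast hn
  by_cases hk : k ≤ n
  · rw [bosonCF_eq_desc_div_asc, Nat.descFactorial_eq_prod_range, Nat.ascFactorial_eq_prod_range]
    -- reorder the falling factorial upwards: `∏_{i<k} (n − i) = ∏_{i<k} (n − (k − 1 − i))`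
    rw [← prod_range_reflect (fun i => n - i) k]
    push_cast
    rw [← Finset.prod_div_distrib]
    refine prod_congr rfl fun i hi => ?_
    have hi' : i < k := mem_range.mp hi
    have h1 : k - 1 - i ≤ n := by omega
    have h2 : (0 : ℝ) < n + i := by positivity
    rw [Nat.cast_sub h1, Nat.cast_sub (by omega : i ≤ k - 1), Nat.cast_sub (by omega : 1 ≤ k)]
    field_simp
    ring
  · -- both sides vanish: `C(n,k) = 0`, and the factor `i = k − 1 − n` of the product is zero
    push Not at hk
    have hL : bosonCF n k = 0 := by
      unfold bosonCF; rw [Nat.choose_eq_zero_of_lt hk]; simp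
    rw [hL, eq_comm]
    refine prod_eq_zero (i := k - 1 - n) (mem_range.mpr (by omega)) ?_
    rw [Nat.cast_sub (by omega : n ≤ k - 1), Nat.cast_sub (by omega : 1 ≤ k)]
    push_cast
    have : (n : ℝ) + ((k : ℝ) - 1 - n) = (k : ℝ) - 1 := by ring
    rw [this, div_self (by
      have : (1 : ℝ) < k := by exact_mod_cast (show 1 < k by omega)
      linarith), sub_self]

/-- Weierstrass' product inequality: for `x_i ∈ [0, 1]`, `∏ (1 − x_i) ≥ 1 − Σ x_i` (plumbing for the
converse direction). [folklore] -/
private theorem one_sub_sum_le_prod_one_sub {ι : Type*} (s : Finset ι) (x : ι → ℝ)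
    (h0 : ∀ i ∈ s, 0 ≤ x i) (h1 : ∀ i ∈ s, x i ≤ 1) :
    1 - ∑ i ∈ s, x i ≤ ∏ i ∈ s, (1 - x i) := by
  classical
  induction s using Finset.induction_on with
  | empty => simp
  | insert a s ha ih =>
    rw [sum_insert ha, prod_insert ha]
    have ih' := ih (fun i hi => h0 i (mem_insert_of_mem hi)) (fun i hi => h1 i (mem_insert_of_mem hi))
    have ha0 := h0 a (mem_insert_self a s)
    have ha1 := h1 a (mem_insert_self a s)
    have hs0 : 0 ≤ ∑ i ∈ s, x i := sum_nonneg fun i hi => h0 i (mem_insert_of_mem hi)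
    nlinarith [mul_nonneg ha0 hs0, mul_le_mul_of_nonneg_left ih' (sub_nonneg.mpr ha1)]

/-- **The converse direction of the bosonic birthday paradox, as printed**: with `n ≥ 1` modes and
`k ≥ 1` bosons, `C(n,k)/(n multichoose k) > 1 − k²/n` — so for `n ≫ k²` the collision-free
configurations carry almost all of the uniform law (“when m ≫ n², the basis states with two or
more photons in the same mode can safely be neglected”).
[cite: AaronsonArkhipovToC2013, Appendix 13 (“> 1 − n²/m”, display before Thm 72, arXiv numbering)] -/
theorem one_sub_sq_div_lt_bosonCF {n k : ℕ} (hn : 0 < n) (hk : 0 < k) :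
    1 - (k : ℝ) ^ 2 / n < bosonCF n k := by
  have hnR : (0 : ℝ) < n := by exact_mod_cast hn
  have hkR : (1 : ℝ) ≤ k := by exact_mod_cast hk
  by_cases hkn : k ≤ n + 1
  · rw [bosonCF_eq_prod_one_sub hn]
    -- `1 − k²/n < 1 − Σ_{i<k} (k−1)/(n+i) ≤ ∏_{i<k} (1 − (k−1)/(n+i))`
    have hx0 : ∀ i ∈ range k, 0 ≤ ((k : ℝ) - 1) / (n + i) := fun i _ => by positivity
    have hx1 : ∀ i ∈ range k, ((k : ℝ) - 1) / (n + i) ≤ 1 := fun i _ => by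
      rw [div_le_one (by positivity)]
      have : (k : ℝ) ≤ n + 1 := by exact_mod_cast hkn
      have : (0 : ℝ) ≤ i := by positivity
      linarith
    refine lt_of_lt_of_le ?_ (one_sub_sum_le_prod_one_sub _ _ hx0 hx1)
    have hsum : ∑ i ∈ range k, ((k : ℝ) - 1) / (n + i) ≤ ∑ _i ∈ range k, ((k : ℝ) - 1) / n := by
      refine sum_le_sum fun i _ => ?_
      have : (0 : ℝ) ≤ i := by positivity
      exact div_le_div_of_nonneg_left (by linarith) hnR (by linarith)
    rw [sum_const, card_range, nsmul_eq_mul] at hsum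
    have hlt : (k : ℝ) * ((k - 1) / n) < (k : ℝ) ^ 2 / n := by
      rw [mul_div_assoc', div_lt_div_iff_of_pos_right hnR]; nlinarith
    linarith
  · -- `k ≥ n + 2`: the left side is negative and `bosonCF = 0`
    push Not at hkn
    have hL : bosonCF n k = 0 := by
      unfold bosonCF; rw [Nat.choose_eq_zero_of_lt (by omega : n < k)]; simp
    rw [hL, sub_neg, lt_div_iff₀ hnR, one_mul]
    have : (n : ℝ) + 2 ≤ k := by exact_mod_cast hkn
    nlinarith

/-- **Unitary Pigeonhole Principle, doubly-stochastic core (AA Lemma 69)**: if every column of a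
non-negative matrix `R` sums to one, then `Σ_{x∈G} Σ_{y∈B} r_xy ≤ |B|` — so for `x` uniform on `G`,
`Pr[y ∈ B] = |G|⁻¹ Σ_{x∈G} Σ_{y∈B} r_xy ≤ |B|/|G|`. (AA apply it to `r_xy = |u_xy|²` for a unitary
`U`, which is doubly stochastic: `colSum_normSq_eq_one`.)
[cite: AaronsonArkhipovToC2013, Appendix 13 Lemma 69 (arXiv numbering: Unitary Pigeonhole Principle)] -/
theorem sum_sum_le_card_of_colSum_eq_one {ι : Type*} [Fintype ι] (R : ι → ι → ℝ)
    (hnn : ∀ x y, 0 ≤ R x y) (hcol : ∀ y, ∑ x, R x y = 1) (G B : Finset ι) :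
    ∑ x ∈ G, ∑ y ∈ B, R x y ≤ B.card := by
  calc ∑ x ∈ G, ∑ y ∈ B, R x y ≤ ∑ x, ∑ y ∈ B, R x y :=
        sum_le_univ_sum_of_nonneg fun x => sum_nonneg fun y _ => hnn x y
    _ = ∑ y ∈ B, ∑ x, R x y := sum_comm
    _ = ∑ y ∈ B, (1 : ℝ) := sum_congr rfl fun y _ => hcol y
    _ = B.card := by simp

/-- The averaged form `Pr[y ∈ B] ≤ |B|/|G|` for `x` uniform on a non-empty good part `G`.
[cite: AaronsonArkhipovToC2013, Appendix 13 Lemma 69 (arXiv numbering)] -/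
theorem unitaryPigeonhole {ι : Type*} [Fintype ι] (R : ι → ι → ℝ)
    (hnn : ∀ x y, 0 ≤ R x y) (hcol : ∀ y, ∑ x, R x y = 1) {G : Finset ι} (hG : G.Nonempty)
    (B : Finset ι) :
    (∑ x ∈ G, ∑ y ∈ B, R x y) / G.card ≤ (B.card : ℝ) / G.card :=
  div_le_div_of_nonneg_right (sum_sum_le_card_of_colSum_eq_one R hnn hcol G B)
    (by exact_mod_cast hG.card_pos.le)

/-- “Let R be an M × M doubly-stochastic matrix whose (x, y) entry is r_xy := |u_xy|²”: the columns
of `(|u_xy|²)` sum to one when `U` is unitary (`Uᴴ U = 1`). [cite: AaronsonArkhipovToC2013, Appendix 13 Lemma 69 (proof)] -/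
theorem colSum_normSq_eq_one {ι : Type*} [Fintype ι] [DecidableEq ι] {U : Matrix ι ι ℂ}
    (hU : U.conjTranspose * U = 1) (y : ι) : ∑ x, ‖U x y‖ ^ 2 = 1 := by
  have h := congrFun (congrFun hU y) y
  rw [Matrix.mul_apply, Matrix.one_apply_eq] at h
  simp only [Matrix.conjTranspose_apply] at h
  have h' : ∑ x, ((‖U x y‖ ^ 2 : ℝ) : ℂ) = 1 := by
    rw [← h]
    refine sum_congr rfl fun x _ => ?_
    rw [RCLike.star_def, RCLike.conj_mul]; norm_cast
  exact_mod_cast h'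

end Literature.Combinatorics.Enumerative.BosonicBirthday
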